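import Summits.QuantumAdvantage.AdviceFreeQNC0.CodegThreeTop
import Summits.QuantumAdvantage.AdviceFreeQNC0.LiftFromTransversal
import HarnessLib

/-!
# Cell qa-qnc0 (rung F-S1, route RingFrame, crux α, line `tensor`): R1U at co-degree three —
# `LiftOneUCodegThree : LiftOneUAt 4 7` (qn-p2 ROUND-5 THEOREM E3, ask R5-f)

Planner qa-qnc0-p2's ROUND-5 reduces the rung R1U (`LiftOneU`) to fixed-gap instances `LiftOneUAt c K`
(`L' = d + c`, co-degree `e = c − 1`).  E1 (`c = 2`) is `CodegOne.lean`, E2 (`c = 3`) is `CodegTwo.lean`.  This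
file proves

* **THEOREM E3** `liftOneUCodegThree : LiftOneUCodegThree` (`:= LiftOneUAt 4 7`, Sketch5 verbatim): at
  `L' = d + 4`, radius `w ≤ 8`, every matrix `X` with LINEAR columns whose rows are `w`-close to `RM(d, d+4)` is
  `7·(d+2)·w·2^L`-close to a matrix with linear columns and rows in `RM(d, d+4)`.

Proof (ROUND-5 §2.3 as a DIMENSION COUNT), `m = d + 4`: `V = syn3(rows of X)` is a linear space each of whose
elements is the order-`≤ 3` syndrome of the LEADER `X(u,·) ⊕ Y(u,·)` (`≤ w` points) of an actual row
(`exists_leader_of_mem_V`).  Filtration by the restriction `low2` to order `≤ 2` and then by parity/point sums: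
`dim V ≤ (m + 1) + 7m + dim K₂`, where `7m` is MESHULAM for the moment matrices `Σ_{v ∈ a} v vᵀ` of zero-sum
leaders (rank `≤ |a| − 1 ≤ 7`, `CodegThreeSyndrome`) and `K₂` — the syndromes in `V` vanishing to order `2` — is
the TOP LAYER, of dimension `≤ m − 2` or `≤ 16` by the clique lemma and Chow's star/top theorem
(`finrank_top_le`, using `Literature.LinearAlgebra.Subspace.grassmannClique_star_or_top`); for
`d ≤ 3` the coordinate count `dim V ≤ Σ_{j<4} C(m,j) ∈ {15, 26, 42, 64}` is used instead.  Either way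
`dim V ≤ 14(d+2)`, the union `Z` of one leader per basis vector is a TRANSVERSAL with `#Z ≤ w·dim V`
(`card_Z_le`, as in `CodegTwo`), and the literature seat's `exists_lift_of_transversal` gives a lift of cost
`≤ 2^{L−1}·#Z ≤ 7(d+2)·w·2^L`.

The cell's theorem (planner qa-qnc0-p2 gen 5 ROUND-5 §2.3 / ask R5-f; seat qa-qnc0-lit gen 11, 2026-08-27).
WHAT THIS IS NOT: not the transversal bound `cov ≤ 60m + 4` of ROUND-5 (the STAR transversal is not
formalised); nothing on co-degree `≥ 4` (`e = 4` needs Kasami–Tokura–Azumi / SR(8)), `LiftOneU`, α or the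
separation.

## References

* R. Meshulam, Quart. J. Math. Oxford 36 (1985) 225–229, Thm 2 [Meshulam1985]; W.-L. Chow, Ann. of Math. 50
  (1949) / M. Pankov, *Geometry of Semilinear Embeddings* §3.2 Prop 3.3 [Pankov2014] (through the Literature files).
-/

noncomputable section

namespace Summit.QuantumAdvantage.AdviceFreeQNC0

open Finset Module
open Literature.Computability.MetaComplexity Literature.Computability.MetaComplexity.Smolensky
open MeanLoad Syndrome2 Syndrome3

/-- **THEOREM E3** (qn-p2 ROUND-5 §2.3, `Sketch5.LiftOneUCodegThree` verbatim; co-degree 3, `f = 16`, radius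
`8`): constant `K = 7`. -/
def LiftOneUCodegThree : Prop := LiftOneUAt 4 7

namespace CodegThree

variable {L d : ℕ}

/-! ### Rows, leaders, the row-syndrome space -/

/-- the `𝔽₂`-row of `X` at `u`. -/
def rowZ (X : BMat L (d + 4)) (u : Fin L → Bool) : CubeFn (ZMod 2) (d + 4) :=
  fun v => if X u v = true then 1 else 0

/-- the LEADER of row `u`: the columns where `X` and `Y` differ (`#leader = rowDist`). -/
def leader (X Y : BMat L (d + 4)) (u : Fin L → Bool) : Finset (Fin (d + 4) → Bool) :=
  univ.filter fun v => X u v ≠ Y u v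

/-- `#leader = rowDist`. -/
theorem card_leader (X Y : BMat L (d + 4)) (u : Fin L → Bool) : (leader X Y u).card = rowDist X Y u :=
  rfl

/-- `X(u,·) = Y(u,·) + 𝟙_{leader}` in `𝔽₂`. -/
theorem rowZ_eq_add_indF (X Y : BMat L (d + 4)) (u : Fin L → Bool) :
    rowZ X u = rowZ Y u + indF (leader X Y u) := by
  funext v
  unfold rowZ indF leader
  simp only [Finset.mem_filter, Finset.mem_univ, true_and, Pi.add_apply]
  cases X u v <;> cases Y u v <;> decide

/-- **The syndrome of a row is the syndrome of its leader** (the degree-`d` part is in the kernel). -/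
theorem syn3_rowZ {X Y : BMat L (d + 4)} (hY : RowsDeg d Y) (u : Fin L → Bool) :
    syn3 (rowZ X u) = syn3 (indF (leader X Y u)) := by
  rw [rowZ_eq_add_indF X Y u, map_add]
  have h : rowZ Y u ∈ LinearMap.ker (syn3 (m := d + 4)) := by
    rw [ker_syn3_eq_lowDeg]
    exact hY u
  rw [LinearMap.mem_ker] at h
  rw [h, zero_add]

/-- Rows of a matrix with linear columns are additive. -/
theorem rowZ_bx {X : BMat L (d + 4)} (hX : LinCols X) (u u' : Fin L → Bool) :
    rowZ X (bx u u') = rowZ X u + rowZ X u' := by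
  funext v
  show (if X (bx u u') v = true then (1 : ZMod 2) else 0) = _
  rw [apply_bx_of_linCols hX u u' v, ind_xor]
  rfl

/-- The row at `u = 0` vanishes (linear columns). -/
theorem rowZ_zero {X : BMat L (d + 4)} (hX : LinCols X) : rowZ X (fun _ => false) = 0 := by
  funext v
  show (if X (fun _ => false) v = true then (1 : ZMod 2) else 0) = 0
  rw [hX.2 v]
  rfl

/-- **The row-syndrome space** `V = syn3 (span of the rows of X)`. -/
def V (X : BMat L (d + 4)) : Submodule (ZMod 2) (Finset (Fin (d + 4)) → ZMod 2) :=
  (Submodule.span (ZMod 2) (Set.range (rowZ X))).map syn3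

/-- Row syndromes lie in `V`. -/
theorem syn3_rowZ_mem (X : BMat L (d + 4)) (u : Fin L → Bool) : syn3 (rowZ X u) ∈ V X :=
  Submodule.mem_map_of_mem (Submodule.subset_span ⟨u, rfl⟩)

/-- Every element of the span of the rows is a row (the rows form a subspace, as the columns are linear). -/
theorem exists_row_of_mem_span {X : BMat L (d + 4)} (hX : LinCols X) {g : CubeFn (ZMod 2) (d + 4)}
    (hg : g ∈ Submodule.span (ZMod 2) (Set.range (rowZ X))) : ∃ u, rowZ X u = g := by
  induction hg using Submodule.span_induction with
  | mem g hg =>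
    obtain ⟨u, rfl⟩ := hg
    exact ⟨u, rfl⟩
  | zero => exact ⟨fun _ => false, rowZ_zero hX⟩
  | add g g' _ _ hg hg' =>
    obtain ⟨u, rfl⟩ := hg
    obtain ⟨u', rfl⟩ := hg'
    exact ⟨bx u u', rowZ_bx hX u u'⟩
  | smul c g _ hg =>
    obtain ⟨u, rfl⟩ := hg
    have hc : c = 0 ∨ c = 1 := by revert c; decide
    rcases hc with rfl | rfl
    · exact ⟨fun _ => false, by rw [rowZ_zero hX, zero_smul]⟩
    · exact ⟨u, by rw [one_smul]⟩

/-- **Every element of `V` is the syndrome of an actual row.** -/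
theorem exists_row_of_mem_V {X : BMat L (d + 4)} (hX : LinCols X) {s : Finset (Fin (d + 4)) → ZMod 2}
    (hs : s ∈ V X) : ∃ u, syn3 (rowZ X u) = s := by
  obtain ⟨g, hg, rfl⟩ := Submodule.mem_map.1 hs
  obtain ⟨u, hu⟩ := exists_row_of_mem_span hX hg
  exact ⟨u, by rw [hu]⟩

/-- Every element of `V` is the syndrome of a LEADER (`≤ w` points). -/
theorem exists_leader_of_mem_V {X Y : BMat L (d + 4)} (hX : LinCols X) (hY : RowsDeg d Y)
    {s : Finset (Fin (d + 4)) → ZMod 2} (hs : s ∈ V X) : ∃ u, syn3 (indF (leader X Y u)) = s := by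
  obtain ⟨u, rfl⟩ := exists_row_of_mem_V hX hs
  exact ⟨u, (syn3_rowZ hY u).symm⟩

/-- Elements of `V` vanish beyond order `3`. -/
theorem apply_eq_zero_of_mem_V {X : BMat L (d + 4)} {s : Finset (Fin (d + 4)) → ZMod 2} (hs : s ∈ V X)
    {J : Finset (Fin (d + 4))} (hJ : ¬ J.card ≤ 3) : s J = 0 := by
  obtain ⟨g, -, rfl⟩ := Submodule.mem_map.1 hs
  exact syn3_apply_of_gt g hJ

/-! ### The dimension of the row-syndrome space -/

/-- **COORDINATE COUNT**: `dim V ≤ Σ_{j<4} C(d+4, j)`. -/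
theorem finrank_V_le_count (X : BMat L (d + 4)) :
    finrank (ZMod 2) (V X) ≤ ∑ j ∈ Finset.range 4, (d + 4).choose j :=
  finrank_le_of_vanishing (V X) fun _ hs _ hJ => apply_eq_zero_of_mem_V hs hJ

/-- the parity / point-sum coordinates of a syndrome (`none ↦ s_∅`, `some i ↦ s_{i}`). -/
def parity1 : (Finset (Fin (d + 4)) → ZMod 2) →ₗ[ZMod 2] (Option (Fin (d + 4)) → ZMod 2) where
  toFun s o := Option.elim o (s ∅) (fun i => s {i})
  map_add' s t := by funext o; cases o <;> rfl
  map_smul' c s := by funext o; cases o <;> rfl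

variable {X Y : BMat L (d + 4)} {w : ℕ}

/-- **STRUCTURAL BOUND** (`d ≥ 1`, radius `w ≤ 8`): `dim V ≤ (m + 1) + 7m + max (m − 2) 16`, `m = d + 4` —
parity/point-sum layer, quadratic layer (Meshulam, rank `≤ 7`), top layer (clique lemma + Chow). -/
theorem finrank_V_le_struct (hd : 1 ≤ d) (hX : LinCols X) (hY : RowsDeg d Y) (hdist : ∀ u, rowDist X Y u ≤ w)
    (hw8 : w ≤ 8) : finrank (ZMod 2) (V X) ≤ (d + 4 + 1) + 7 * (d + 4) + max (d + 2) 16 := by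
  -- split `V` along `low2`
  set f := low2.domRestrict (V X) with hf
  have hrn := LinearMap.finrank_range_add_finrank_ker f
  -- (a) the TOP LAYER `ker f`
  have hker : finrank (ZMod 2) (LinearMap.ker f) ≤ max (d + 2) 16 := by
    set K₂ := (LinearMap.ker f).map (V X).subtype with hK₂
    have hKeq : finrank (ZMod 2) K₂ = finrank (ZMod 2) (LinearMap.ker f) := Submodule.finrank_map_subtype_eq _ _
    rw [← hKeq]
    have hmem : ∀ s ∈ K₂, s ∈ V X ∧ ∀ J : Finset (Fin (d + 4)), J.card ≤ 2 → s J = 0 := by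
      intro s hs
      rw [hK₂, Submodule.mem_map] at hs
      obtain ⟨⟨s', hs'V⟩, hk, rfl⟩ := hs
      rw [LinearMap.mem_ker, hf, LinearMap.domRestrict_apply] at hk
      exact ⟨hs'V, (low2_eq_zero_iff _).1 hk⟩
    have h := finrank_top_le hd K₂
      (fun s hs => by
        obtain ⟨u, hu⟩ := exists_leader_of_mem_V hX hY (hmem s hs).1
        exact ⟨leader X Y u, (hdist u).trans hw8, hu⟩)
      (fun s hs => (hmem s hs).2)
    rcases h with h | h
    · exact h.trans (le_max_left _ _)
    · exact h.trans (le_max_right _ _)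
  -- (b) the lower layers `range f`: parity/point sums, then Meshulam with rank `≤ 7`
  have hrange : finrank (ZMod 2) (LinearMap.range f) ≤ (d + 4 + 1) + 7 * (d + 4) := by
    set V₂ := LinearMap.range f with hV₂
    have hmem2 : ∀ t ∈ V₂, ∃ u, t = low2 (syn3 (indF (leader X Y u))) := by
      intro t ht
      obtain ⟨⟨s, hsV⟩, rfl⟩ := LinearMap.mem_range.1 ht
      obtain ⟨u, hu⟩ := exists_leader_of_mem_V hX hY hsV
      exact ⟨u, by rw [hf, LinearMap.domRestrict_apply, hu]⟩
    set g := parity1.domRestrict V₂ with hg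
    have hrn2 := LinearMap.finrank_range_add_finrank_ker g
    have hgr : finrank (ZMod 2) (LinearMap.range g) ≤ d + 4 + 1 := by
      refine (Submodule.finrank_le _).trans ?_
      rw [Module.finrank_fintype_fun_eq_card, Fintype.card_option, Fintype.card_fin]
    have hgk : finrank (ZMod 2) (LinearMap.ker g) ≤ 7 * (d + 4) := by
      set K₁ := (LinearMap.ker g).map V₂.subtype with hK₁
      have hKeq : finrank (ZMod 2) K₁ = finrank (ZMod 2) (LinearMap.ker g) := Submodule.finrank_map_subtype_eq _ _
      rw [← hKeq]
      have hmem1 : ∀ t ∈ K₁, t ∈ V₂ ∧ t ∅ = 0 ∧ ∀ i, t {i} = 0 := by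
        intro t ht
        rw [hK₁, Submodule.mem_map] at ht
        obtain ⟨⟨t', ht'V⟩, hk, rfl⟩ := ht
        rw [LinearMap.mem_ker, hg, LinearMap.domRestrict_apply] at hk
        exact ⟨ht'V, congrFun hk none, fun i => congrFun hk (some i)⟩
      refine finrank_le_mul_of_rank_le 7 K₁ (fun t ht => (hmem1 t ht).2.1) (fun t ht J hJ => ?_) (fun t ht => ?_)
      · obtain ⟨u, rfl⟩ := hmem2 t (hmem1 t ht).1
        rw [low2_apply, if_neg hJ]
      · obtain ⟨htV, -, h1⟩ := hmem1 t ht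
        obtain ⟨u, rfl⟩ := hmem2 t htV
        rw [momMat_low2, momMat_syn3_indF]
        refine rank_momMat_le_seven _ ((hdist u).trans hw8) fun i => ?_
        have h := h1 i
        rw [low2_apply, if_pos (by simp), syn3_indF_singleton] at h
        exact h
    omega
  omega

/-! ### The transversal -/

section Transversal

variable (X Y) (hX : LinCols X)

/-- a basis of the row-syndrome space. -/
def bV : Basis (Fin (finrank (ZMod 2) (V X))) (ZMod 2) (V X) := Module.finBasis (ZMod 2) (V X)

/-- a row realising the `i`-th basis syndrome. -/
def pick (i : Fin (finrank (ZMod 2) (V X))) : Fin L → Bool :=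
  Classical.choose (exists_row_of_mem_V hX (bV X i).2)

/-- `pick` realises the basis syndrome. -/
theorem syn3_pick (i : Fin (finrank (ZMod 2) (V X))) : syn3 (rowZ X (pick X hX i)) = (bV X i : _) :=
  Classical.choose_spec (exists_row_of_mem_V hX (bV X i).2)

/-- the leader attached to the `i`-th basis syndrome (as an `𝔽₂`-word). -/
def ldr (i : Fin (finrank (ZMod 2) (V X))) : CubeFn (ZMod 2) (d + 4) := indF (leader X Y (pick X hX i))

/-- **The linear representative map**: the basis syndrome `b_i` gets its leader, extended linearly. -/
def rep : V X →ₗ[ZMod 2] CubeFn (ZMod 2) (d + 4) := (bV X).constr (ZMod 2) (ldr X Y hX)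

/-- `rep s` has syndrome `s`. -/
theorem syn3_rep (hY : RowsDeg d Y) (s : V X) : syn3 (rep X Y hX s) = (s : _) := by
  have h : syn3.comp (rep X Y hX) = (V X).subtype := by
    refine (bV X).ext fun i => ?_
    rw [LinearMap.comp_apply, Submodule.subtype_apply]
    unfold rep
    rw [Basis.constr_basis]
    unfold ldr
    rw [← syn3_rowZ hY, syn3_pick]
  exact LinearMap.congr_fun h s

/-- **The transversal**: the union of the chosen leaders. -/
def Z : Finset (Fin (d + 4) → Bool) := univ.biUnion fun i => leader X Y (pick X hX i)

/-- `rep s` is supported on `Z`. -/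
theorem rep_apply_eq_zero (s : V X) {v : Fin (d + 4) → Bool} (hv : v ∉ Z X Y hX) : rep X Y hX s v = 0 := by
  unfold rep
  rw [Basis.constr_apply_fintype, Finset.sum_apply]
  refine Finset.sum_eq_zero fun i _ => ?_
  have hvi : v ∉ leader X Y (pick X hX i) := fun h =>
    hv (Finset.mem_biUnion.2 ⟨i, Finset.mem_univ _, h⟩)
  simp [ldr, indF, hvi]

/-- **`#Z ≤ w · dim V`.** -/
theorem card_Z_le (hdist : ∀ u, rowDist X Y u ≤ w) : (Z X Y hX).card ≤ w * finrank (ZMod 2) (V X) := by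
  unfold Z
  refine (Finset.card_biUnion_le).trans ?_
  calc ∑ i : Fin (finrank (ZMod 2) (V X)), (leader X Y (pick X hX i)).card
      ≤ ∑ _i : Fin (finrank (ZMod 2) (V X)), w :=
        Finset.sum_le_sum fun i _ => by rw [card_leader]; exact hdist _
    _ = w * finrank (ZMod 2) (V X) := by
        rw [Finset.sum_const, Finset.card_univ, Fintype.card_fin, smul_eq_mul, mul_comm]

/-- **Every row has a `Z`-supported representative of its coset mod `RM(d, d+4)`** (the hypothesis of
`exists_lift_of_transversal`). -/
theorem exists_rep (hY : RowsDeg d Y) (u : Fin L → Bool) :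
    ∃ v : (Fin (d + 4) → Bool) → Bool, (∀ p, v p = true → p ∈ Z X Y hX) ∧
      HasDeg (fun p => xor (X u p) (v p)) d := by
  set s : V X := ⟨syn3 (rowZ X u), syn3_rowZ_mem X u⟩ with hs
  refine ⟨fun p => decide (rep X Y hX s p = 1), fun p hp => ?_, ?_⟩
  · by_contra hZ
    have hp' : decide (rep X Y hX s p = 1) = true := hp
    rw [rep_apply_eq_zero X Y hX s hZ] at hp'
    exact absurd hp' (by decide)
  · show (fun p => if xor (X u p) (decide (rep X Y hX s p = 1)) = true then (1 : ZMod 2) else 0) ∈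
      lowDeg (ZMod 2) (d + 4) d
    have h : (fun p => if xor (X u p) (decide (rep X Y hX s p = 1)) = true then (1 : ZMod 2) else 0) =
        rowZ X u + rep X Y hX s := by
      funext p
      rw [ind_xor, LiftFromTransversal.zmod2_ind_decide]
      rfl
    rw [h, ← ker_syn3_eq_lowDeg d, LinearMap.mem_ker, map_add, syn3_rep X Y hX hY]
    funext J
    exact CharTwo.add_self_eq_zero _

end Transversal

/-- **`dim V ≤ 14 (d + 2)`** in all cases (radius `w ≤ 8`). -/
theorem finrank_V_le (hX : LinCols X) (hY : RowsDeg d Y) (hdist : ∀ u, rowDist X Y u ≤ w) (hw8 : w ≤ 8) :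
    finrank (ZMod 2) (V X) ≤ 14 * (d + 2) := by
  by_cases hd : 4 ≤ d
  · have h := finrank_V_le_struct (by omega) hX hY hdist hw8
    rcases Nat.le_total (d + 2) 16 with h16 | h16
    · rw [max_eq_right h16] at h; omega
    · rw [max_eq_left h16] at h; omega
  · have h := finrank_V_le_count X
    interval_cases d
    · have e : ∑ j ∈ Finset.range 4, (0 + 4).choose j = 15 := by decide
      omega
    · have e : ∑ j ∈ Finset.range 4, (1 + 4).choose j = 26 := by decide
      omega
    · have e : ∑ j ∈ Finset.range 4, (2 + 4).choose j = 42 := by decide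
      omega
    · have e : ∑ j ∈ Finset.range 4, (3 + 4).choose j = 64 := by decide
      omega

end CodegThree

/-! ### THEOREM E3 -/

/-- **THEOREM E3: `liftOneUCodegThree : LiftOneUCodegThree`** (R1U at co-degree three, constant `K = 7`).
[cite: Meshulam1985, Thm 2] [cite: Pankov2014, §3.2 Prop 3.3] -/
theorem liftOneUCodegThree : LiftOneUCodegThree := by
  intro L d w hw2 X Y hX hY hdist
  have hw8 : w ≤ 8 := by
    have : (2 : ℕ) ^ 4 = 16 := by norm_num
    omega
  rcases Nat.eq_zero_or_pos w with rfl | hwpos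
  · -- `w = 0`: the rows of `X` are those of `Y`; `W = X`
    refine ⟨X, hX, fun u => ?_, ?_⟩
    · have e : X u = Y u := row_eq_of_rowDist_eq_zero (Nat.le_zero.1 (hdist u))
      have hYu := hY u
      rw [← e] at hYu
      exact hYu
    · rw [hw_xorM_self]
      simp
  rcases Nat.eq_zero_or_pos L with rfl | hLpos
  · -- `L = 0`: the only row index is `0`, where `X` vanishes; `W = X`
    refine ⟨X, hX, fun u => ?_, ?_⟩
    · have hu : u = fun _ => false := funext fun i => Fin.elim0 i
      subst hu
      show (fun v => if X (fun _ => false) v = true then (1 : ZMod 2) else 0) ∈ lowDeg (ZMod 2) (d + 4) d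
      have h : (fun v => if X (fun _ => false) v = true then (1 : ZMod 2) else 0) = 0 :=
        funext fun v => by rw [hX.2 v]; rfl
      rw [h]
      exact Submodule.zero_mem _
    · rw [hw_xorM_self, Nat.cast_zero]
      positivity
  -- main case: the transversal and the linear lift
  obtain ⟨W, hW, hWd, hcost⟩ :=
    exists_lift_of_transversal (CodegThree.Z X Y hX) hX (CodegThree.exists_rep X Y hX hY)
  refine ⟨W, hW, hWd, ?_⟩
  have hpow : 2 ^ L = 2 * 2 ^ (L - 1) := by
    rw [← Nat.pow_succ']; congr 1; omega
  have hZ : (CodegThree.Z X Y hX).card ≤ 14 * (d + 2) * w := by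
    have hV := CodegThree.finrank_V_le hX hY hdist hw8
    calc (CodegThree.Z X Y hX).card ≤ w * finrank (ZMod 2) (CodegThree.V X) := CodegThree.card_Z_le X Y hX hdist
      _ ≤ w * (14 * (d + 2)) := Nat.mul_le_mul_left _ hV
      _ = 14 * (d + 2) * w := by ring
  have hnat : hw (xorM X W) ≤ 7 * (d + 2) * w * 2 ^ L := by
    refine hcost.trans ?_
    rw [hpow]
    calc 2 ^ (L - 1) * (CodegThree.Z X Y hX).card ≤ 2 ^ (L - 1) * (14 * (d + 2) * w) :=
          Nat.mul_le_mul_left _ hZ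
      _ = 7 * (d + 2) * w * (2 * 2 ^ (L - 1)) := by ring
  have hR : ((hw (xorM X W) : ℕ) : ℝ) ≤ ((7 * (d + 2) * w * 2 ^ L : ℕ) : ℝ) := by
    exact_mod_cast hnat
  refine hR.trans (le_of_eq ?_)
  push_cast
  ring

/-- Shape check: the statement is `LiftOneUAt 4 7` (Sketch5 `LiftOneUCodegThree` verbatim). -/
example : LiftOneUAt 4 7 := liftOneUCodegThree

end Summit.QuantumAdvantage.AdviceFreeQNC0

end
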